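import Summits.BirchSwinnertonDyer.BirchSwinnertonDyer.Theorems.ClassRecordThreeEulerHalvesAtThreeShimuraFamilyKummerPlacesTamagawa
import Summits.BirchSwinnertonDyer.BirchSwinnertonDyer.Theorems.ErratumRoadFiveEulerHalfNotRamE0PrimeReceptacle
import HarnessLib

/-!
# Crux 23422 `EulerHalvesAtThreeResidualUpperBound`, line `cartan`, stub (DIV_C) — port 1/4: Gross 6.2 (1) (Kummer membership of the family
# classes at every `v ∤ m`) on a CARTAN frame: the inert clause weakened to «inert-unramified», Cartan places served by complete splitting

Seat `bsd-stepL-tam3-p1` (g20), LINE OWNER of crux 23422 (`--supports stmt-BirchSwinnertonDyer-23422 --as helper`). The registered stub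
`stub_cartanDivAtThree` of `Cruxes/EulerHalvesAtThreeResidualUpperBound/Lines/cartan.lean` v6′ (the `hDivLab` input of bsd-idea-10's PROVED
unramified ORDER machine `ShimuraKolyvaginOfImage.cartanOrderMachineAtThree`) is, on the Eichler locus, the tree's Jetchev walk (bsd-jet §6 END on
the `ShimuraWalk` swap ∕ level supplies). Its port to Cartan frames (inert multiplicative set `S`, inert-unramified ADDITIVE Cartan set `C`, every
other bad prime split) needs the supplies' single-datum PRODUCERS re-keyed. THIS FILE re-keys the Kummer producer's core: tam3-p1 g15's
`kolyvaginClass_familyData_mem_selmerLocalKer_of_tamagawa` with `S` replaced by an arbitrary set `T` of inert-unramified bad primes (`T = S ∪ C`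
downstream) — the proof is that theorem's text with ONE line changed: at `q ∈ T` the (R1) lemma is called through
`kolyvaginClass_mem_selmerLocalKer_of_span_natCast_ringClassField` ∘ `asIdeal_eq_span_natCast_of_ncard_primesOver_eq_one`, which consume only
«prime, `q ∣ N`, one prime above `q`, `q ∤ d_K`» (never `¬ q² ∣ N`). HONEST FRAMING: one theorem (no definition, no named fact, no `sorry`);
CONDITIONAL on its displayed binders exactly as the parent; nothing about any CM point is constructed; no stub closes by this file alone; BSD is
proved for no curve; T7. Credit: corner3-p2 g8 (p600152), tam3-p1 g15 (p614xxx), shim-p1 ((R1)), x11b3 (ENDs).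
-- adapted from Summits/BirchSwinnertonDyer/BirchSwinnertonDyer/Theorems/ClassRecordThreeEulerHalvesAtThreeShimuraFamilyKummerPlacesTamagawa.lean (one branch re-keyed)
References: [cite: GrossLMS1991, §6 Prop. 6.2 (1) (pp. 244–245), §4 (4.1)] [cite: McCallumLMS1991, Lemma 4.3] [cite: Howard2004Duke, Lemma 3.1.5]
[cite: MilneADT2006, Ch. I Prop. 3.8] [cite: KohenPacetti2016, §3 p. 14 (Cartan–Heegner hypothesis: the Cartan primes are inert in K)].
presearch: n/a (re-keying of a tree theorem).
-/

set_option autoImplicit false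
set_option linter.dupNamespace false

noncomputable section

open scoped Classical

namespace Summit.BirchSwinnertonDyer.BirchSwinnertonDyer.Theorems.CartanDiv

open WeierstrassCurve Field NumberField IsDedekindDomain Finset
  Literature.NumberTheory.EllipticCurves Literature.NumberTheory.GaloisRepresentations
  Literature.NumberTheory.EllipticCurves.KolyvaginCocycle
  Literature.NumberTheory.EllipticCurves.KolyvaginEuler
  Literature.NumberTheory.EllipticCurves.RingClassField
  Literature.NumberTheory.EllipticCurves.ModularForms
  Summit.BirchSwinnertonDyer.Rank1Residual.X11b Summit.BirchSwinnertonDyer.Rank1Residual.X11b.Three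
  Summit.BirchSwinnertonDyer.Rank1Residual.X11b.Three.GrossBadPlace Summit.BirchSwinnertonDyer.Rank1Residual.X11b.KolyvaginHloc
  Summit.BirchSwinnertonDyer.Rank1Residual.JET
  Summit.BirchSwinnertonDyer.BirchSwinnertonDyer.Theorems
  Summit.BirchSwinnertonDyer.BirchSwinnertonDyer.Theorems.ShimuraWalk
  Literature.NumberTheory.EllipticCurves.ShimuraCMFamily Literature.NumberTheory.Automorphic

variable {K : Type} [Field K] [NumberField K] {W : WeierstrassCurve ℚ}

set_option maxHeartbeats 800000 in
/-- **Gross 1991 Prop. 6.2 (1) at every finite `v ∤ m` for a family of generalised Kolyvagin data on a CARTAN frame** — tam3-p1 g15's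
`ShimuraWalk.kolyvaginClass_familyData_mem_selmerLocalKer_of_tamagawa` (p61xxxx, `…ShimuraFamilyKummerPlacesTamagawa`) VERBATIM with the inert
clause WEAKENED: the set `T` of INERT-UNRAMIFIED bad primes need not be multiplicative (`ℓ.Prime ∧ ℓ ∣ N ∧ #primesOver = 1 ∧ ℓ ∤ d_K`, the conjunct
`¬ ℓ² ∣ N` dropped — the proof never used it): at a place `v = q𝓞_K` over `q ∈ T` the prime is principal, so `v` splits completely in `K[m]` and the
class is a Kummer class (`kolyvaginClass_mem_selmerLocalKer_of_span_natCast_ringClassField`, shim-p1's (R1)) — for the non-split CARTAN places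
(additive IV ∕ IV*, `q² ∥ N`, `c_v = 3`) exactly as for the inert multiplicative ones, with NO receptacle and NO Tamagawa hypothesis there; the
`E⁰`-receptacle `hrec` is asked only at the carriers over `q ∉ T`, the Tamagawa-free places over `q ∉ T` are served by Milne I.3.8 (`hM38`).
[cite: GrossLMS1991, §6 Prop. 6.2 (1), Prop. 3.7 (1), §3 (3.3), Lemma 4.3, §4 (4.1)] [cite: McCallumLMS1991, Lemma 4.3]
[cite: Howard2004Duke, Lemma 3.1.5] [cite: MilneADT2006, Ch. I Prop. 3.8] -/
theorem kolyvaginClass_familyData_mem_selmerLocalKer_of_tamagawa_inertUnram {N : ℕ} [NeZero N] [W.IsElliptic] [W.IsGloballyMinimal]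
    (hK : IsImaginaryQuadratic K) (ι : K →+* ℂ) (hN : W.conductorNorm ℤ = N)
    {p M : ℕ} (hp : p.Prime) (hM : 1 ≤ M) (Dt : ModularParametrizationData W N)
    (hM38 : ∀ (v : HeightOneSpectrum (𝓞 K)) {𝔐 : Ideal (v.localAbsIntegers)}, 𝔐 ∈ v.localPrimesAbove →
      ∀ f : contOneCocycles (discreteTopRep (absoluteGaloisGroup (v.adicCompletion K))
          (localPoints (W.baseChange K) (v.adicCompletion K))),
        (∀ σ ∈ 𝔐.inertia (absoluteGaloisGroup (v.adicCompletion K)), f.1 σ = 0) →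
        (((W.baseChange K).baseChange (v.adicCompletion K)).localTamagawaNumber (v.adicCompletionIntegers K) : ℤ) •
          oneCocycleClass (discreteTopRep (absoluteGaloisGroup (v.adicCompletion K))
            (localPoints (W.baseChange K) (v.adicCompletion K))) f = 0)
    {T : Finset ℕ}
    (hinT : ∀ ℓ ∈ T, ℓ.Prime ∧ ℓ ∣ N ∧
      ((Ideal.span {(ℓ : ℤ)}).primesOver (𝓞 K)).ncard = 1 ∧ ¬ (ℓ : ℤ) ∣ NumberField.discr K)
    {n : ℕ} (hn : Squarefree n)
    (hKol : ∀ q ∈ n.primeFactors, IsKolyvaginPrime N W K p q ∧ FrobEqFrobInfty W K (p ^ M) q)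
    (d : (m : ℕ) → m ∣ n → KolyvaginFamilyData W K ι m)
    (hB4d : ∀ (m : ℕ) (hm : m ∣ n), ∀ (ℓ : ℕ) (hℓ : ℓ ∈ m.primeFactors)
      (hle : ringClassField K ι (m / ℓ) ≤ ringClassField K ι m),
      ∑ i ∈ Finset.range (ℓ + 1), pointGalHom W (ringClassField K ι m) ((d m hm).σ ℓ ^ i) (d m hm).y =
        W.frobeniusTrace ℓ • WeierstrassCurve.Affine.Point.map (W' := W)
          ((RingClassField.inclusion ι hle).restrictScalars ℚ)
          (d (m / ℓ) ((Nat.div_dvd_of_dvd (Nat.dvd_of_mem_primeFactors hℓ)).trans hm)).y)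
    {n' : ℤ} (hcop : IsCoprime ((p ^ M : ℕ) : ℤ) n')
    (hrec : ∀ (q : ℕ), q.Prime → q ∣ N → q ∉ T → ∀ (m : ℕ) (hm : m ∣ n)
      (γ : ringClassField K ι m ≃ₐ[ℚ] ringClassField K ι m) (v : HeightOneSpectrum (𝓞 K)),
      ((q : ℕ) : 𝓞 K) ∈ v.asIdeal →
      p ∣ ((W.baseChange K).baseChange (v.adicCompletion K)).localTamagawaNumber (v.adicCompletionIntegers K) →
        n' • pointsMap (W.baseChange K) (v.adicCompletion K)
            ((d m hm).toGeomPoints (pointGalHom W (ringClassField K ι m) γ (d m hm).y)) ∈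
          E0Receptacle (W.baseChange K) v ∧
        ∀ (ℓ : ℕ) (hℓ : ℓ ∈ m.primeFactors)
          (hle : ringClassField K ι (m / ℓ) ≤ ringClassField K ι m),
          n' • pointsMap (W.baseChange K) (v.adicCompletion K)
              ((d m hm).toGeomPoints (pointGalHom W (ringClassField K ι m) γ
                (WeierstrassCurve.Affine.Point.map (W' := W)
                  ((RingClassField.inclusion ι hle).restrictScalars ℚ)
                  (d (m / ℓ) ((Nat.div_dvd_of_dvd (Nat.dvd_of_mem_primeFactors hℓ)).trans hm)).y))) ∈
            E0Receptacle (W.baseChange K) v)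
    (hA : ∀ (m : ℕ) (hm : m ∣ n),
      IsAdmissible (absoluteGaloisGroup K) (d m hm).pointsSubgroup ((p ^ M : ℕ) : ℤ)) :
    ∀ (m : ℕ) (hm : m ∣ n) (v : HeightOneSpectrum (𝓞 K)), (m : 𝓞 K) ∉ v.asIdeal →
      (d m hm).kolyvaginClass hp M ∈
        selmerLocalKer (W.baseChange K) (v.adicCompletion K) ((p ^ M : ℕ) : ℤ) := by
  intro m hm v hmv
  haveI : Fact p.Prime := ⟨hp⟩
  haveI : (W.baseChange K).IsElliptic := inferInstanceAs (W.map (algebraMap ℚ K)).IsElliptic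
  have hn0 : n ≠ 0 := Squarefree.ne_zero hn
  have hm0 : m ≠ 0 := ne_zero_of_dvd_ne_zero hn0 hm
  have hinert : ∀ q ∈ n.primeFactors, (Ideal.span {(q : 𝓞 K)}).IsPrime :=
    fun q hq ↦ (hKol q hq).1.2.2.2.2.1
  have hmN : ∀ q ∈ m.primeFactors, ¬ q ∣ N := fun q hq ↦ (hKol q (Nat.primeFactors_mono hm hn0 hq)).1.2.1
  have hdiv : ∀ Q : geomPoints (W.baseChange K), ∃ R, ((p ^ M : ℕ) : ℤ) • R = Q :=
    (W.baseChange K).zsmul_geomPoints_surjective_of_charZero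
      (by exact_mod_cast pow_ne_zero M hp.ne_zero)
  -- the structures of the level-data package
  letI hcg : ∀ k, CommGroup (ringClassGal ι k) := fun k ↦
    { (inferInstance : Group (ringClassGal ι k)) with
      mul_comm := fun a b ↦ (KolyvaginH44.isMulCommutative_ringClassGal' hK ι k).is_comm.comm a b }
  letI act : ∀ k, DistribMulAction (ringClassGal ι k)
      ((W.baseChange (ringClassField K ι k)).toAffine.Point) := fun k ↦
    DistribMulAction.compHom _ ((pointGalHom W (ringClassField K ι k)).comp (ringClassGal ι k).subtype)
  -- THE SEAM: level data at every level (`exists_levelData_familyData`)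
  choose σ H hF f y π j e hord hj hπρ hfsec hHρ hdict hjunk using
    fun k ↦ exists_levelData_familyData (W := W) hK ι hn hinert d k
  letI hft : ∀ k, Fintype (ringClassGal ι k ⧸ H k) := hF
  have hsmul : ∀ (k) (g : ringClassGal ι k) (Q : (W.baseChange (ringClassField K ι k)).toAffine.Point),
      g • Q = pointGalHom W (ringClassField K ι k)
        (g : ringClassField K ι k ≃ₐ[ℚ] ringClassField K ι k) Q := fun _ _ _ ↦ rfl
  set ρ : ∀ k, ringClassGal ι k →* (ringClassField K ι k ≃ₐ[ℚ] ringClassField K ι k) :=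
    fun k ↦ (ringClassGal ι k).subtype with hρdef
  have hρ : ∀ k, Function.Injective (ρ k) := fun k ↦ (ringClassGal ι k).subtype_injective
  have hj' : ∀ (k) (g : absoluteGaloisGroup K)
      (a : (W.baseChange (ringClassField K ι k)).toAffine.Point),
      j k (π k g • a) = g • j k a := fun k g a ↦ by rw [hsmul]; exact hj k g a
  have hπρ' : ∀ (k) (τ : absoluteGaloisGroup K) (x : ringClassField K ι k),
      τ • e k x = e k (ρ k (π k τ) x) := fun k τ x ↦ hπρ k τ x
  -- the dictionary at the divisor `m`
  obtain ⟨hjm, hym, hσm, hfS, hem, hPm⟩ := hdict m hm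
  have hle : ∀ {ℓ : ℕ}, ℓ ∈ m.primeFactors → ringClassField K ι (m / ℓ) ≤ ringClassField K ι m :=
    fun hℓ ↦ ringClassField_mono hK ι (Nat.div_dvd_of_dvd (Nat.dvd_of_mem_primeFactors hℓ)) hm0
  have hm' : ∀ {ℓ : ℕ}, ℓ ∈ m.primeFactors → m / ℓ ∣ n := fun hℓ ↦
    (Nat.div_dvd_of_dvd (Nat.dvd_of_mem_primeFactors hℓ)).trans hm
  -- (B4) ∧ (3.3): `Tr_ℓ y(m) = a_ℓ • y(m/ℓ)↑` with `p^M ∣ a_ℓ`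
  have hrel : ∀ ℓ ∈ m.primeFactors, ∀ (hℓ : ℓ ∈ m.primeFactors),
      grAct ((W.baseChange (ringClassField K ι m)).toAffine.Point) (traceElt (σ m ℓ) ℓ) (y m) =
        W.frobeniusTrace ℓ • WeierstrassCurve.Affine.Point.map (W' := W)
          ((RingClassField.inclusion ι (hle hℓ)).restrictScalars ℚ) (d (m / ℓ) (hm' hℓ)).y := by
    intro ℓ _ hℓ
    rw [grAct_traceElt, hym, ← hB4d m hm ℓ hℓ (hle hℓ)]
    refine Finset.sum_congr rfl fun i _ ↦ ?_
    rw [hsmul, Subgroup.coe_pow, hσm ℓ hℓ]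
  have haℓ : ∀ ℓ ∈ m.primeFactors, ((p ^ M : ℕ) : ℤ) ∣ W.frobeniusTrace ℓ := fun ℓ hℓ ↦
    pow_dvd_frobeniusTrace_of_kolyvaginPrime (K := K) Dt hp hM (hKol ℓ (Nat.primeFactors_mono hm hn0 hℓ)).1
      (hKol ℓ (Nat.primeFactors_mono hm hn0 hℓ)).2
  have htrA : ∀ ℓ ∈ m.primeFactors,
      grAct ((W.baseChange (ringClassField K ι m)).toAffine.Point) (traceElt (σ m ℓ) ℓ) (y m) ∈
        zsmulRange ((W.baseChange (ringClassField K ι m)).toAffine.Point) ((p ^ M : ℕ) : ℤ) :=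
    fun ℓ hℓ ↦ grAct_traceElt_mem_of_eq_smul (hrel ℓ hℓ hℓ) (haℓ ℓ hℓ)
  -- `hgen`, `hdvd`, `hA`, `hPt`, `hI` at level `m`, abstract currency
  have hgen : H m ≤ Subgroup.closure (σ m '' (m.primeFactors : Set ℕ)) :=
    le_closure_of_map_zpowers hK ι (hn.squarefree_of_dvd hm) (σ m) (H m) (ρ m) (hρ m)
      (fun q hq ↦ by
        rw [MonoidHom.map_zpowers]
        change Subgroup.zpowers (σ m q : ringClassField K ι m ≃ₐ[ℚ] ringClassField K ι m) = _
        rw [hσm q hq]; exact (d m hm).zpowers_σ q hq)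
      (hHρ m)
  have hdvd : ∀ ℓ ∈ m.primeFactors, ((p ^ M : ℕ) : ℤ) ∣ ((ℓ + 1 : ℕ) : ℤ) := by
    intro ℓ hℓ
    obtain ⟨hℓK, hℓM⟩ := hKol ℓ (Nat.primeFactors_mono hm hn0 hℓ)
    exact (IsKolyvaginPrime.pow_dvd_add_one W hp hℓK hM hℓM).1
  have hA' : IsAdmissible (absoluteGaloisGroup K) (j m).range ((p ^ M : ℕ) : ℤ) := by
    rw [hjm]; exact hA m hm
  have hPt' : j m (kolyvaginPoint (σ m) m.primeFactors (f m) (y m)) ∈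
      invPoints (absoluteGaloisGroup K) (j m).range ((p ^ M : ℕ) : ℤ) :=
    map_kolyvaginPoint_mem_invPoints (hfsec m) hgen (hord m) hdvd htrA (π m) (j m) (hj' m)
  obtain ⟨𝔐, h𝔐⟩ := v.localPrimesAbove_nonempty
  have hI' : ∀ t ∈ 𝔐.inertia (absoluteGaloisGroup (v.adicCompletion K)),
      resGal (K := K) (v.adicCompletion K) t • j m (kolyvaginPoint (σ m) m.primeFactors (f m) (y m)) =
        j m (kolyvaginPoint (σ m) m.primeFactors (f m) (y m)) :=
    KolyvaginH44.smul_kolyvaginPoint_eq_of_mem_localInertia (W := W) hK ι σ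
      (fun k ↦ k.primeFactors) H f y π j hj' e ρ hρ hπρ' m v hmv 𝔐 h𝔐
  have hrat : ∀ Φ : absoluteGaloisGroup K, (∀ x : ringClassField K ι m, Φ • e m x = e m x) →
      Φ • j m (kolyvaginPoint (σ m) m.primeFactors (f m) (y m)) =
        j m (kolyvaginPoint (σ m) m.primeFactors (f m) (y m)) :=
    KolyvaginH44.hrat_of_galoisDictionary ι σ (fun k ↦ k.primeFactors) H f y π j hj' e ρ hρ hπρ' m hm0
  -- the abstract class IS the datum's class `c_M(m)`
  have hP : j m (kolyvaginPoint (σ m) m.primeFactors (f m) (y m)) =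
      (d m hm).toGeomPoints (d m hm).derivedPoint := by rw [hjm, hPm]
  have hPt : (d m hm).toGeomPoints (d m hm).derivedPoint ∈
      invPoints (absoluteGaloisGroup K) (d m hm).pointsSubgroup ((p ^ M : ℕ) : ℤ) := by
    have h := hPt'
    rw [hP, hjm] at h
    exact h
  have hc : (d m hm).kolyvaginClass hp M =
      kolyvaginClass (W.baseChange K) ((p ^ M : ℕ) : ℤ) hdiv hA'
        (j m (kolyvaginPoint (σ m) m.primeFactors (f m) (y m))) hPt' := by
    rw [KolyvaginFamilyData.kolyvaginClass_def, dif_pos ⟨hA m hm, hPt⟩]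
    exact KolyvaginH44.kolyvaginClass_congr (by rw [hjm]; rfl) hP.symm
  rw [hc]
  -- Gross Prop. 6.2 (1) by the reduction type of `E/K` at `v`
  by_cases hgood : (W.baseChange K).HasGoodReductionAt v
  · exact kolyvaginClass_mem_selmerLocalKer_of_inertia_of_hasGoodReductionAt (W.baseChange K) hA'
      hPt' v hgood h𝔐 hI'
  -- bad `v` lies over a prime `q ∣ N`
  set u : HeightOneSpectrum (𝓞 ℚ) := v.under (𝓞 ℚ) with hudef
  set q : ℕ := (Rat.HeightOneSpectrum.primesEquiv u : ℕ) with hqdef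
  have hqP : q.Prime := (Rat.HeightOneSpectrum.primesEquiv u).2
  have hqu : (q : 𝓞 ℚ) ∈ u.asIdeal :=
    (natCast_mem_asIdeal_iff_eq_primesEquiv_symm u hqP).mpr (Equiv.symm_apply_apply _ u).symm
  have hqv : ((q : ℕ) : 𝓞 K) ∈ v.asIdeal := by
    have h1 : (q : 𝓞 ℚ) ∈ v.asIdeal.under (𝓞 ℚ) := hqu
    rw [Ideal.under_def, Ideal.mem_comap, map_natCast] at h1
    exact h1
  have hqN : q ∣ N := by
    by_contra hqN
    haveI : v.asIdeal.LiesOver u.asIdeal := ⟨rfl⟩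
    exact hgood (hasGoodReductionAt_baseChange_of_hasGoodReductionAt_rat W u v
      (hasGoodReductionAt_of_not_dvd_conductorNorm W u (by rw [hN]; exact hqN)))
  by_cases hqS : q ∈ T
  · -- (R1) at an INERT-UNRAMIFIED place (multiplicative of the inert set OR an additive Cartan place alike):
    -- `v = q𝓞_K` is principal, splits completely in `K[m]`, so the class is locally a Kummer class
    obtain ⟨hqp', hqN', hg, hd⟩ := hinT q hqS
    have hqm : Nat.Coprime q m := (Nat.Prime.coprime_iff_not_dvd hqp').mpr fun h ↦
      hmN q (Nat.mem_primeFactors.mpr ⟨hqp', h, hm0⟩) hqN'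
    exact kolyvaginClass_mem_selmerLocalKer_of_span_natCast_ringClassField hK ι hm0 (e m)
      (asIdeal_eq_span_natCast_of_ncard_primesOver_eq_one hK hqp' hg hd hqv) hqm (W.baseChange K) hA' hPt' hrat
  -- a TAMAGAWA-FREE place over `q ∉ T` (`p ∤ c_v`): Milne I.3.8 (`hM38`) through tam3-p1 g15's mechanism, NO receptacle
  by_cases hcv : p ∣ ((W.baseChange K).baseChange (v.adicCompletion K)).localTamagawaNumber (v.adicCompletionIntegers K)
  swap
  · exact TamagawaFreePlace.kolyvaginClass_mem_selmerLocalKer_of_inertia_of_localTamagawaNumber_smul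
      (W.baseChange K) hA' hPt' v hI' (TamagawaFreePlace.isCoprime_pow_natCast_of_not_dvd hp M hcv) (hM38 v h𝔐)
  -- a CARRIER place over `q ∉ T` (`p ∣ c_v`): the `E⁰(K̄_v)`-receptacle END
  set Sg : Set ((W.baseChange (ringClassField K ι m)).toAffine.Point) :=
    {x | ∃ γ : ringClassGal ι m, x = γ • (d m hm).y ∨ ∃ (ℓ : ℕ) (hℓ : ℓ ∈ m.primeFactors),
      x = γ • WeierstrassCurve.Affine.Point.map (W' := W)
        ((RingClassField.inclusion ι (hle hℓ)).restrictScalars ℚ) (d (m / ℓ) (hm' hℓ)).y}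
    with hSgdef
  have hSstab : ∀ (g : ringClassGal ι m), ∀ s ∈ Sg, g • s ∈ Sg := by
    rintro g s ⟨γ, h | ⟨ℓ, hℓ, h⟩⟩
    · refine ⟨g * γ, Or.inl ?_⟩
      rw [h]; exact (mul_smul g γ _).symm
    · refine ⟨g * γ, Or.inr ⟨ℓ, hℓ, ?_⟩⟩
      rw [h]; exact (mul_smul g γ _).symm
  have hyS : y m ∈ Sg := by
    rw [hym]; exact ⟨1, Or.inl (one_smul _ _).symm⟩
  have hzS : ∀ (ℓ : ℕ) (hℓ : ℓ ∈ m.primeFactors),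
      WeierstrassCurve.Affine.Point.map (W' := W)
        ((RingClassField.inclusion ι (hle hℓ)).restrictScalars ℚ) (d (m / ℓ) (hm' hℓ)).y ∈ Sg :=
    fun ℓ hℓ ↦ ⟨1, Or.inr ⟨ℓ, hℓ, (one_smul _ _).symm⟩⟩
  have hrecS : ∀ s ∈ Sg, n' • pointsMap (W.baseChange K) (v.adicCompletion K) (j m s) ∈
      E0Receptacle (W.baseChange K) v := by
    rintro s ⟨γ, h | ⟨ℓ, hℓ, h⟩⟩
    · rw [h, hjm, hsmul]
      exact (hrec q hqP hqN hqS m hm γ v hqv hcv).1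
    · rw [h, hjm, hsmul]
      exact (hrec q hqP hqN hqS m hm γ v hqv hcv).2 ℓ hℓ (hle hℓ)
  have htr : ∀ ℓ ∈ m.primeFactors,
      grAct ((W.baseChange (ringClassField K ι m)).toAffine.Point) (traceElt (σ m ℓ) ℓ) (y m) ∈
        (AddSubgroup.closure Sg).map (zsmulAddGroupHom ((p ^ M : ℕ) : ℤ) :
          (W.baseChange (ringClassField K ι m)).toAffine.Point →+ _) := by
    intro ℓ hℓ
    obtain ⟨k, hk⟩ := haℓ ℓ hℓ
    refine AddSubgroup.mem_map.mpr ⟨k • WeierstrassCurve.Affine.Point.map (W' := W)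
        ((RingClassField.inclusion ι (hle hℓ)).restrictScalars ℚ) (d (m / ℓ) (hm' hℓ)).y,
      AddSubgroup.zsmul_mem _ (AddSubgroup.subset_closure (hzS ℓ hℓ)) k, ?_⟩
    rw [zsmulAddGroupHom_apply, smul_smul, ← hk, hrel ℓ hℓ hℓ]
  exact kolyvaginClass_kolyvaginPoint_mem_selmerLocalKer_of_GZ31_E0 (W.baseChange K) (hfsec m)
    hgen (hord m) hdvd (π m) (j m) (hj' m) hA' hPt' v h𝔐 hI'
    (E' := AddSubgroup.closure Sg) (n' := n')
    ⟨fun γ e he ↦ smul_mem_closure_of_forall_smul_mem hSstab γ he,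
      AddSubgroup.subset_closure hyS, htr,
      fun x hx ↦ zsmul_map_mem_of_mem_closure
        ((pointsMap (W.baseChange K) (v.adicCompletion K)).comp (j m))
        (E0Receptacle (W.baseChange K) v) n' hrecS hx⟩
    hcop

/-! ### §2 The Kummer producer from the E′-labels at the carriers off `T` -/

set_option maxHeartbeats 800000 in
/-- **The Kummer producer `hSel` on a CARTAN frame** (Gross 6.2 (1): `c_M(d) ∈ Sel_𝔳` at every finite `𝔳 ∤ n`) for EVERY datum `d` with
`d.y = ys n` on a frame `(W, N, K, T)` with `T` an arbitrary set of INERT-UNRAMIFIED bad primes (multiplicative or additive Cartan), every other bad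
prime split, carrying `LabelsAt`, the E′-LABELS AT THE CARRIER PRIMES OUTSIDE `T` (`hE0T`), Milne I.3.8 (`hM38`), admissible `E(K[m])` — er5-w3's
`kolyvaginClass_familyData_mem_selmerLocalKer_of_labelsAt_of_tamagawa_of_E0Prime` VERBATIM with `S ↦ T` and the inert clause weakened (no `¬ ℓ² ∣ N`),
the core being §1's port `kolyvaginClass_familyData_mem_selmerLocalKer_of_tamagawa_inertUnram`.
[cite: GrossLMS1991, §6 Prop. 6.2 (1), p. 245] [cite: Jetchev2008, Prop. 4.6, Cor. 4.8] [cite: MilneADT2006, Ch. I Prop. 3.8] -/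
theorem kolyvaginClass_familyData_mem_selmerLocalKer_of_labelsAt_of_tamagawa_of_E0Prime_inertUnram {N : ℕ} [NeZero N] [W.IsElliptic]
    [W.IsGloballyMinimal]
    (hK : IsImaginaryQuadratic K) (ι : K →+* ℂ) (hN : W.conductorNorm ℤ = N) {p : ℕ} [Fact p.Prime]
    (Dt : ModularParametrizationData W N) [∀ j : ℕ, NumberField (ringClassField K ι j)]
    {T : Finset ℕ}
    (hinT : ∀ ℓ ∈ T, ℓ.Prime ∧ ℓ ∣ N ∧
      ((Ideal.span {(ℓ : ℤ)}).primesOver (𝓞 K)).ncard = 1 ∧ ¬ (ℓ : ℤ) ∣ NumberField.discr K)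
    (hsp : ∀ ℓ : ℕ, ℓ.Prime → ℓ ∣ N → ℓ ∉ T → ((Ideal.span {(ℓ : ℤ)}).primesOver (𝓞 K)).ncard = 2)
    (ys : (m : ℕ) → (W.baseChange (ringClassField K ι m)).toAffine.Point)
    {yK : (W.baseChange K).toAffine.Point} {ε : ℤ} (hL : LabelsAt W N K ι yK ys ε)
    (hE0T : ∀ (q : ℕ) [Fact q.Prime], q ∣ N → q ∉ T → p ∣ (W.baseChange ℚ_[q]).localTamagawaNumber ℤ_[q] →
      ∃ n' : ℕ, ¬ p ∣ n' ∧ ∀ m : ℕ, Squarefree m → (∀ r ∈ m.primeFactors, ¬ r ∣ N ∧ (Ideal.span {(r : 𝓞 K)}).IsPrime) →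
        ∀ [NumberField (ringClassField K ι m)] (w : HeightOneSpectrum (𝓞 (ringClassField K ι m))),
          ((q : ℕ) : 𝓞 (ringClassField K ι m)) ∈ w.asIdeal →
          (placeIntModel W (ringClassField K ι m) w).HasNonsingularReduction (K := ringClassField K ι m) (n' • ys m))
    (hM38 : ∀ (v : HeightOneSpectrum (𝓞 K)) {𝔐 : Ideal (v.localAbsIntegers)}, 𝔐 ∈ v.localPrimesAbove →
      ∀ f : contOneCocycles (discreteTopRep (absoluteGaloisGroup (v.adicCompletion K))
          (localPoints (W.baseChange K) (v.adicCompletion K))),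
        (∀ σ ∈ 𝔐.inertia (absoluteGaloisGroup (v.adicCompletion K)), f.1 σ = 0) →
        (((W.baseChange K).baseChange (v.adicCompletion K)).localTamagawaNumber (v.adicCompletionIntegers K) : ℤ) •
          oneCocycleClass (discreteTopRep (absoluteGaloisGroup (v.adicCompletion K))
            (localPoints (W.baseChange K) (v.adicCompletion K))) f = 0)
    (hA : ∀ (m : ℕ) (dm : KolyvaginFamilyData W K ι m), dm.y = ys m → Squarefree m →
      (∀ q ∈ m.primeFactors, IsKolyvaginPrime N W K p q) →
      ∀ j : ℕ, IsAdmissible (absoluteGaloisGroup K) dm.pointsSubgroup ((p ^ j : ℕ) : ℤ))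
    (M n : ℕ) (d : KolyvaginFamilyData W K ι n) (hM : 1 ≤ M) (hdy : d.y = ys n) (hn : Squarefree n)
    (hKol : ∀ q ∈ n.primeFactors, IsKolyvaginPrime N W K p q ∧ FrobEqFrobInfty W K (p ^ M) q)
    (𝔳 : HeightOneSpectrum (𝓞 K)) (h𝔳 : (n : 𝓞 K) ∉ 𝔳.asIdeal) :
    d.kolyvaginClass (Fact.out : p.Prime) M ∈ selmerLocalKer (W.baseChange K) (𝔳.adicCompletion K) ((p ^ M : ℕ) : ℤ) := by
  have hp : p.Prime := Fact.out
  have hn0 : n ≠ 0 := hn.ne_zero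
  have hguard : ∀ q ∈ n.primeFactors, ¬ q ∣ N ∧ (Ideal.span {(q : 𝓞 K)}).IsPrime :=
    fun q hq ↦ ⟨(hKol q hq).1.2.1, (hKol q hq).1.2.2.2.2.1⟩
  obtain ⟨D, hDd, hDy⟩ := exists_familyData_extension (W := W) hK ι hn (fun q hq ↦ (hguard q hq).2) ys d hdy
  subst hDd
  obtain ⟨hB4d, -, -⟩ := familyLabels_of_labelsAt (W := W) hn hguard ys hL D hDy
  -- ONE exponent for every carrier outside `T`
  obtain ⟨n', hpn', hE0⟩ := ShimuraKolyvaginOfImage.exists_uniform_exponent_of_carrierLabelsE0Prime W ι p T ys hE0T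
  have hcop1 : IsCoprime (p : ℤ) (n' : ℤ) :=
    Nat.isCoprime_iff_coprime.mpr ((Nat.Prime.coprime_iff_not_dvd hp).mpr hpn')
  have hcop : IsCoprime ((p ^ M : ℕ) : ℤ) (n' : ℤ) := by
    rw [Nat.cast_pow]; exact hcop1.pow_left
  have hA' : ∀ (m : ℕ) (hm : m ∣ n), IsAdmissible (absoluteGaloisGroup K) (D m hm).pointsSubgroup ((p ^ M : ℕ) : ℤ) :=
    fun m hm ↦ hA m (D m hm) (hDy m hm) (hn.squarefree_of_dvd hm)
      (fun q hq ↦ (hKol q (Nat.primeFactors_mono hm hn0 hq)).1) M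
  have hrec : ∀ (q : ℕ), q.Prime → q ∣ N → q ∉ T → ∀ (m : ℕ) (hm : m ∣ n)
      (γ : ringClassField K ι m ≃ₐ[ℚ] ringClassField K ι m) (v : HeightOneSpectrum (𝓞 K)),
      ((q : ℕ) : 𝓞 K) ∈ v.asIdeal →
      p ∣ ((W.baseChange K).baseChange (v.adicCompletion K)).localTamagawaNumber (v.adicCompletionIntegers K) →
        (n' : ℤ) • pointsMap (W.baseChange K) (v.adicCompletion K)
            ((D m hm).toGeomPoints (pointGalHom W (ringClassField K ι m) γ (D m hm).y)) ∈
          E0Receptacle (W.baseChange K) v ∧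
        ∀ (ℓ : ℕ) (hℓ : ℓ ∈ m.primeFactors)
          (hle : ringClassField K ι (m / ℓ) ≤ ringClassField K ι m),
          (n' : ℤ) • pointsMap (W.baseChange K) (v.adicCompletion K)
              ((D m hm).toGeomPoints (pointGalHom W (ringClassField K ι m) γ
                (WeierstrassCurve.Affine.Point.map (W' := W)
                  ((RingClassField.inclusion ι hle).restrictScalars ℚ)
                  (D (m / ℓ) ((Nat.div_dvd_of_dvd (Nat.dvd_of_mem_primeFactors hℓ)).trans hm)).y))) ∈
            E0Receptacle (W.baseChange K) v := by
    intro q hqp hqN hqS m hm γ v hqv hcv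
    haveI : Fact q.Prime := ⟨hqp⟩
    have hq2 := hsp q hqp hqN hqS
    have hcq : p ∣ (W.baseChange ℚ_[q]).localTamagawaNumber ℤ_[q] :=
      dvd_localTamagawaNumber_padic_of_dvd_of_ncard_eq_two (W := W) hK q hq2 hqN v hqv hcv
    exact (familyReceptacle_of_labelE0Prime (W := W) hK ι p hn hguard ys hqp hqN hq2 hpn'
      (fun m hm hg w hw ↦ hE0 q hqN hqS hcq m hm hg w hw) D hDy).2 m hm γ v hqv
  exact kolyvaginClass_familyData_mem_selmerLocalKer_of_tamagawa_inertUnram hK ι hN hp hM Dt hM38 hinT hn hKol D hB4d hcop hrec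
    hA' n dvd_rfl 𝔳 h𝔳

end Summit.BirchSwinnertonDyer.BirchSwinnertonDyer.Theorems.CartanDiv

end
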